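import Literature.NumberTheory.CubicFields.IndexPOverring
import HarnessLib

/-!
# Maximality at `p`: `f ∈ U_p` iff `R(f)` has no overring of index divisible by `p` (BTT §2.2, Prop. 2.2 prime by prime)

Topic `Literature/NumberTheory/CubicFields`; the prime-by-prime sharpening of
`DavenportHeilbronnMaximality(Converse).lean` (Prop. 2.2: `R(f)` maximal iff `f ∈ U_p` for all `p`)
using `IndexPOverring.lean` (if `f ∉ U_p` then `R(f)` has an overring of index `p` or `p²`).

Bhargava–Taniguchi–Thorne 2023, §2.2: "We say that a cubic form `f` is maximal at `p` if `f ∈ U_p`"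
— i.e. `R(f) ⊗ ℤ_p` is maximal, i.e. `R(f)` has no overring whose index is divisible by `p`. This
file proves that equivalence on the side of forms, with the index of `φ : R(f) ↪ R(g)` measured by
`detOnQuot φ`:

* `RingOfForm.exists_not_mem_range_of_dvd_detOnQuot` — if `p ∣ detOnQuot φ` then some `x ∉ φ(R f)`
  has `p x ∈ φ(R f)` (the image is not `p`-saturated);
* `RingOfForm.not_memU_of_dvd_detOnQuot` — hence **`f ∉ U_p`** (through the intermediate ring
  `T = φ(R f) + p^{k−1} S_p` of `DavenportHeilbronnMaximalityConverse` and its `not_memU_of_overring`);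
* **`BinaryCubic.memU_iff_forall_not_dvd_detOnQuot`** — **`f ∈ U_p` iff no injective
  `φ : R(f) ↪ R(g)` has `p ∣ detOnQuot φ`** ("`f` is maximal at `p`").

## References

* M. Bhargava, T. Taniguchi, F. Thorne, *Improved error estimates for the Davenport–Heilbronn
  theorems*, Math. Ann. 389 (2024) = arXiv:2107.12819, §2.2 (maximal at p), Prop. 2.2 [BhargavaTaniguchiThorne2023].
-/

namespace Literature.NumberTheory.CubicFields

namespace RingOfForm

open BinaryCubic

variable {f g : BinaryCubic ℤ} (φ : RingOfForm f →+* RingOfForm g) {p : ℕ}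

/-- **If `p ∣ detOnQuot φ` then `φ(R f)` is not `p`-saturated in `R(g)`**: some `x ∉ φ(R f)` has
`p x ∈ φ(R f)`. Proof: the rows of the matrix of `φ` on `R/ℤ` are dependent mod `p`, giving
`r = αω + βθ` with `(α, β) ≢ 0 (mod p)` and `φ(r) ≡ c (mod pR(g))`; if `φ(R f)` were `p`-saturated,
`φ(r) = c + pφ(r')` would force `r = c + pr'`, i.e. `p ∣ α, β`. [folklore] -/
theorem exists_not_mem_range_of_dvd_detOnQuot (hp : p.Prime) (hφ : Function.Injective φ)
    (hpd : (p : ℤ) ∣ detOnQuot φ) : ∃ x : RingOfForm g, x ∉ Set.range φ ∧ (p : RingOfForm g) * x ∈ Set.range φ := by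
  by_contra hsat
  push Not at hsat
  -- rows `n₁ = (φω).yz`, `n₂ = (φθ).yz` are dependent mod `p`: find `(α, β) ≢ 0` with `α n₁ + β n₂ ≡ 0`
  set a₁ := (φ (omega f)).y
  set b₁ := (φ (omega f)).z
  set a₂ := (φ (theta f)).y
  set b₂ := (φ (theta f)).z
  have hdet : (p : ℤ) ∣ a₁ * b₂ - a₂ * b₁ := by simpa [detOnQuot] using hpd
  -- the coefficients: `(α, β) = (b₂, -b₁)` unless both `≡ 0`, else `(a₂, -a₁)` unless both `≡ 0`, else `(1, 0)`
  obtain ⟨α, β, hαβ, hy, hz⟩ : ∃ α β : ℤ, ¬ ((p : ℤ) ∣ α ∧ (p : ℤ) ∣ β) ∧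
      (p : ℤ) ∣ α * a₁ + β * a₂ ∧ (p : ℤ) ∣ α * b₁ + β * b₂ := by
    by_cases h1 : (p : ℤ) ∣ b₂ ∧ (p : ℤ) ∣ b₁
    · by_cases h2 : (p : ℤ) ∣ a₂ ∧ (p : ℤ) ∣ a₁
      · refine ⟨1, 0, fun h => ?_, by simpa using h2.2, by simpa using h1.2⟩
        have : (p : ℤ) ∣ 1 := h.1
        exact hp.one_lt.ne' (by exact_mod_cast Int.eq_one_of_dvd_one (by positivity) this)
      · refine ⟨a₂, -a₁, by rwa [dvd_neg], ⟨0, by ring⟩, ?_⟩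
        have : a₂ * b₁ + -a₁ * b₂ = -(a₁ * b₂ - a₂ * b₁) := by ring
        rw [this, dvd_neg]; exact hdet
    · refine ⟨b₂, -b₁, by rwa [dvd_neg], ?_, ⟨0, by ring⟩⟩
      have : b₂ * a₁ + -b₁ * a₂ = a₁ * b₂ - a₂ * b₁ := by ring
      rw [this]; exact hdet
  -- `r = αω + βθ` has `φ r ≡ (φ r).x (mod p R(g))`
  set r : RingOfForm f := ⟨0, α, β⟩ with hr
  have hry : (p : ℤ) ∣ (φ r - ((φ r).x : RingOfForm g)).y := by
    simp only [sub_y, intCast_y, sub_zero]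
    rw [ringHom_apply_y]; simpa [hr] using hy
  have hrz : (p : ℤ) ∣ (φ r - ((φ r).x : RingOfForm g)).z := by
    simp only [sub_z, intCast_z, sub_zero]
    rw [ringHom_apply_z]; simpa [hr] using hz
  obtain ⟨y', hy'⟩ := hry
  obtain ⟨z', hz'⟩ := hrz
  -- so `φ r - c = p x` with `x = (0, y', z')`
  have hpx : φ r - ((φ r).x : RingOfForm g) = (p : RingOfForm g) * ⟨0, y', z'⟩ := by
    ext
    · simp
    · simpa using hy'
    · simpa using hz'
  -- saturation: `x ∈ φ(R f)`
  have hxmem : (⟨0, y', z'⟩ : RingOfForm g) ∈ Set.range φ := by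
    by_contra hx
    have := hsat ⟨0, y', z'⟩ hx
    exact this ⟨r - ((φ r).x : RingOfForm f), by rw [map_sub, map_intCast, hpx]⟩
  obtain ⟨r', hr'⟩ := hxmem
  -- then `r - c = p r'` in `R(f)`, so `p ∣ α, β`
  have heq : r - ((φ r).x : RingOfForm f) = (p : RingOfForm f) * r' := by
    apply hφ
    rw [map_sub, map_intCast, hpx, map_mul, map_natCast, hr']
  have hα : α = p * r'.y := by simpa [hr] using congrArg RingOfForm.y heq
  have hβ : β = p * r'.z := by simpa [hr] using congrArg RingOfForm.z heq
  exact hαβ ⟨⟨r'.y, hα⟩, ⟨r'.z, hβ⟩⟩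

/-- **An overring of index divisible by `p` forces `f ∉ U_p`** (the prime-by-prime converse of
Prop. 2.2): from a non-`p`-saturated image one builds, as in `exists_prime_overring`, the
intermediate ring `T = φ(R f) + p^{k−1} S_p` with `pT ⊆ φ(R f) ⊊ T`, and `not_memU_of_overring`
applies. [folklore] -/
theorem not_memU_of_dvd_detOnQuot (hp : p.Prime) (hφ : Function.Injective φ) (hpd : (p : ℤ) ∣ detOnQuot φ) :
    ¬ f.MemU p := by
  classical
  obtain ⟨s, hsn, hps⟩ := exists_not_mem_range_of_dvd_detOnQuot φ hp hφ hpd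
  obtain ⟨r₀, hr₀⟩ := hps
  -- the saturation and the minimal exponent `k ≥ 1`
  obtain ⟨N, hN0, hN⟩ := exists_pos_forall_exists_eq_mul hφ
  obtain ⟨K, hK⟩ := exists_pow_forall_satur (φ := φ) hp hN0 hN
  have hk : ∃ k : ℕ, ∀ x ∈ satur p φ, ∃ r, φ r = (p : RingOfForm g) ^ k * x := ⟨K, hK⟩
  set k := Nat.find hk with hkdef
  have hkspec := Nat.find_spec hk
  rw [← hkdef] at hkspec
  have hsS : s ∈ satur p φ := ⟨1, r₀, by rw [pow_one, hr₀]⟩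
  have hk0 : k ≠ 0 := by
    intro h0
    obtain ⟨r, hr⟩ := hkspec s hsS
    rw [h0, pow_zero, one_mul] at hr
    exact hsn ⟨r, hr⟩
  obtain ⟨k', hk'⟩ : ∃ k', k = k' + 1 := ⟨k - 1, by omega⟩
  rw [hk'] at hkspec
  have hmin : ¬ ∀ x ∈ satur p φ, ∃ r, φ r = (p : RingOfForm g) ^ k' * x :=
    Nat.find_min hk (show k' < Nat.find hk by rw [← hkdef, hk']; exact Nat.lt_succ_self k')
  push Not at hmin
  obtain ⟨x₁, hx₁S, hx₁⟩ := hmin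
  -- `T = φ(R f) + p^{k'} S_p`
  let T : Subring (RingOfForm g) :=
    { carrier := {t | ∃ r, ∃ x ∈ satur p φ, t = φ r + (p : RingOfForm g) ^ k' * x}
      mul_mem' := by
        rintro t t' ⟨r, x, hx, rfl⟩ ⟨r', x', hx', rfl⟩
        refine ⟨r * r', φ r * x' + x * φ r' + (p : RingOfForm g) ^ k' * (x * x'), ?_, ?_⟩
        · exact (satur p φ).add_mem ((satur p φ).add_mem ((satur p φ).mul_mem (apply_mem_satur p r) hx')
            ((satur p φ).mul_mem hx (apply_mem_satur p r')))
            ((satur p φ).mul_mem ((satur p φ).pow_mem (natCast_mem (satur p φ) p) k') ((satur p φ).mul_mem hx hx'))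
        · rw [map_mul]; ring
      one_mem' := ⟨1, 0, (satur p φ).zero_mem, by simp⟩
      add_mem' := by
        rintro t t' ⟨r, x, hx, rfl⟩ ⟨r', x', hx', rfl⟩
        exact ⟨r + r', x + x', (satur p φ).add_mem hx hx', by rw [map_add]; ring⟩
      zero_mem' := ⟨0, 0, (satur p φ).zero_mem, by simp⟩
      neg_mem' := by
        rintro t ⟨r, x, hx, rfl⟩
        exact ⟨-r, -x, (satur p φ).neg_mem hx, by rw [map_neg]; ring⟩ }
  have hRT : ∀ r, φ r ∈ T := fun r => ⟨r, 0, (satur p φ).zero_mem, by simp⟩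
  have hpT : ∀ t ∈ T, ∃ r, (p : RingOfForm g) * t = φ r := by
    rintro t ⟨r, x, hx, rfl⟩
    obtain ⟨r', hr'⟩ := hkspec x hx
    refine ⟨(p : RingOfForm f) * r + r', ?_⟩
    rw [map_add, map_mul, map_natCast, hr', pow_succ]; ring
  have ht₀T : (p : RingOfForm g) ^ k' * x₁ ∈ T := ⟨0, x₁, hx₁S, by simp⟩
  have ht₀ : (p : RingOfForm g) ^ k' * x₁ ∉ Set.range φ := by
    rintro ⟨r, hr⟩
    exact hx₁ r hr
  exact not_memU_of_overring hp hφ T hRT hpT ht₀T ht₀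

end RingOfForm

namespace BinaryCubic

open RingOfForm

/-- **`f` is maximal at `p` iff `R(f)` has no overring of index divisible by `p`** (BTT 2023, §2.2:
"`f` is maximal at `p` if `f ∈ U_p`"; Prop. 2.2 prime by prime): `f ∈ U_p` iff no injective
`φ : R(f) ↪ R(g)` has `p ∣ detOnQuot φ`. [cite: BhargavaTaniguchiThorne2023, §2.2 (f maximal at p iff f ∈ U_p)] -/
theorem memU_iff_forall_not_dvd_detOnQuot {f : BinaryCubic ℤ} {p : ℕ} (hp : p.Prime) :
    f.MemU p ↔ ∀ (g : BinaryCubic ℤ) (φ : RingOfForm f →+* RingOfForm g),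
      Function.Injective φ → ¬ (p : ℤ) ∣ detOnQuot φ := by
  constructor
  · intro hU g φ hφ hpd
    exact not_memU_of_dvd_detOnQuot φ hp hφ hpd hU
  · intro h
    by_contra hU
    obtain ⟨g, φ, hφ, hdet⟩ := exists_overring_of_not_memU hp.one_lt hU
    apply h g φ hφ
    rw [← Int.natAbs_dvd_natAbs, Int.natAbs_natCast]
    rcases hdet with hdet | hdet <;> rw [hdet]
    exact Dvd.intro_left (p ^ 1) (by ring)

end BinaryCubic

end Literature.NumberTheory.CubicFields
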